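import Summits.CriticalPhenomena.PercolationContinuityZ3.Theorems.FreeBoxPowerSaving.Negative.FreeBoxPowerSavingBounds
import Summits.CriticalPhenomena.PercolationContinuityZ3.Theorems.FreeBoxSparse.Negative.CentredForms
import Literature.Probability.Percolation.InfraredBoundTriangle

/-!
# Negative / tightness lemmas for the crux `FreeBoxPowerSaving` (stmt-CriticalPhenomena-4447), III:
# the parameter profile and the centred form

For `FA₂(p, n) = fa2 p n = |B(n)|⁻² Σ_{x,y∈B(n)} P_p(x ↔ y in B(n))` on `ℤ³` (part I,
`FreeBoxPowerSavingBounds.lean`):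

* `fa2_subcritical_bound` — for `p < p_c`, `FA₂(p, n) ≤ χ(p) · n^{-3}` with `χ(p) = Σ_z τ_p(0, z) < ∞`
  (tree: `summable_tau_of_lt_criticalProb`); with part I's `exponent_le_three` the subcritical
  exponent is exactly `3` (`freeBoxPowerSaving_analogue_below_criticalProb`).  With the sibling files
  `Theorems/FreeBoxSparse/Negative/DCTFloor.lean` (`freePairAverage_mono`,
  `freeBoxPowerSaving_exponent_le_two`) and part I's `false_at_one`, the profile of
  `p ↦ sup{a : ∃ C, ∀ n ≥ 1, FA₂(p,n) ≤ C n^{-a}}` reads: `3` on `[0, p_c)`, `∈ (0, 2]` at `p_c` iff the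
  crux holds, empty at `p = 1` — the crux is exactly the boundary case.
* `freeBoxPowerSaving_iff_centredPowerSaving` — the crux ⟺ `∃ b < 3, ∃ C, ∀ R ≥ 1,
  Σ_{x∈B(R)} P_{p_c}(0 ↔ x in B(R)) ≤ C R^b` (a centre-rooted free-susceptibility power saving below
  `R³`; the sibling crux stmt-CriticalPhenomena-5786 is the member `b = 5/2`, which therefore implies
  4447 with `a = 1/2`), from the re-rooting inequalities `centredAvg_le_freePairAverage` /
  `freePairAverage_le_centredAvg` of `Theorems/FreeBoxSparse/Negative/CentredForms.lean`.
-/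

namespace Summit.CriticalPhenomena.PercolationContinuityZ3.FreeBoxPowerSavingNegative

open MeasureTheory ProbabilityTheory Filter
open Literature.Probability.Percolation Literature.Probability.LatticeModels
open Literature.Probability.Percolation.DCT16
open Summit.CriticalPhenomena.PercolationContinuityZ3.Theses.PercNonProliferation
open Summit.CriticalPhenomena.PercolationContinuityZ3.Theorems.FreeBoxSparse.Negative
  (centredAvg_le_freePairAverage freePairAverage_le_centredAvg)
open scoped BigOperators Topology

noncomputable section

/-! ## The subcritical regime: exponent exactly `3` -/

/-- `P_p(x ↔ y in S) ≤ τ_p(x, y)`. -/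
theorem real_openConnIn_le_tau (p : unitInterval) (S : Set (Site 3)) (x y : Site 3) :
    (bondPercolation (zdGraph 3) p).real (openConnIn S x y) ≤ tau 3 p x y :=
  measureReal_mono (fun _ hω => reachable_of_pathIn (pathIn_of_mem_openConnIn hω)) (measure_ne_top _ _)

/-- Below `p_c`: `S_p(n) ≤ |B(n)| · χ(p)` with `χ(p) = Σ_z τ_p(0, z) < ∞`. -/
theorem pairSum_le_card_mul_chi (p : unitInterval) (hp : (p : ℝ) < criticalProb (zdGraph 3) 0)
    (n : ℕ) : pairSum p n ≤ ((box 3 n).card : ℝ) * ∑' z : Site 3, tau 3 p 0 z := by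
  have hsum : Summable fun z : Site 3 => tau 3 p 0 z :=
    summable_tau_of_lt_criticalProb (by norm_num) p hp
  unfold pairSum
  calc _ ≤ ∑ x ∈ box 3 n, ∑ y ∈ box 3 n, tau 3 p 0 (y - x) :=
        Finset.sum_le_sum fun x _ => Finset.sum_le_sum fun y _ =>
          (real_openConnIn_le_tau p _ x y).trans_eq (tau_eq_tau_zero_sub p x y)
    _ ≤ ∑ _x ∈ box 3 n, ∑' z : Site 3, tau 3 p 0 z := by
        refine Finset.sum_le_sum fun x _ => ?_
        calc ∑ y ∈ box 3 n, tau 3 p 0 (y - x)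
              = ∑ z ∈ (box 3 n).image (· - x), tau 3 p 0 z := by
                rw [Finset.sum_image fun a _ b _ h => sub_left_injective h]
          _ ≤ ∑' z : Site 3, tau 3 p 0 z := hsum.sum_le_tsum _ fun z _ => tau_nonneg p 0 z
    _ = _ := by rw [Finset.sum_const, nsmul_eq_mul]

/-- **Below `p_c` the crux's bound holds with the maximal exponent `3`**: `FA₂(p, n) ≤ χ(p) n^{-3}`. -/
theorem fa2_subcritical_bound (p : unitInterval) (hp : (p : ℝ) < criticalProb (zdGraph 3) 0)
    {n : ℕ} (hn : 1 ≤ n) : fa2 p n ≤ (∑' z : Site 3, tau 3 p 0 z) * (n : ℝ) ^ (-(3 : ℝ)) := by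
  have hχ : 0 ≤ ∑' z : Site 3, tau 3 p 0 z := tsum_nonneg fun z => tau_nonneg p 0 z
  have hnpos : (0 : ℝ) < n := by exact_mod_cast hn
  have hn0 : (n : ℝ) ≠ 0 := hnpos.ne'
  have hcard : (n : ℝ) ^ 3 ≤ ((box 3 n).card : ℝ) := by
    rw [card_box_real]
    have : (n : ℝ) ≤ 2 * n + 1 := by linarith
    calc (n : ℝ) ^ 3 ≤ (2 * (n : ℝ) + 1) ^ 3 := by gcongr
      _ = _ := by ring
  have hc := card_box_pos n
  unfold fa2
  rw [div_le_iff₀ (pow_pos hc 2)]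
  have hrp : (n : ℝ) ^ (-(3 : ℝ)) = ((n : ℝ) ^ 3)⁻¹ := by
    rw [Real.rpow_neg hnpos.le, show ((3 : ℝ)) = ((3 : ℕ) : ℝ) by norm_num, Real.rpow_natCast]
  calc pairSum p n ≤ ((box 3 n).card : ℝ) * ∑' z : Site 3, tau 3 p 0 z := pairSum_le_card_mul_chi p hp n
    _ = (∑' z : Site 3, tau 3 p 0 z) * (n : ℝ) ^ (-(3 : ℝ)) * ((n : ℝ) ^ 3 * ((box 3 n).card : ℝ)) := by
        rw [hrp]; field_simp
    _ ≤ (∑' z : Site 3, tau 3 p 0 z) * (n : ℝ) ^ (-(3 : ℝ)) *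
          (((box 3 n).card : ℝ) * ((box 3 n).card : ℝ)) := by
        have hK : 0 ≤ (∑' z : Site 3, tau 3 p 0 z) * (n : ℝ) ^ (-(3 : ℝ)) :=
          mul_nonneg hχ (Real.rpow_nonneg hnpos.le _)
        exact mul_le_mul_of_nonneg_left (mul_le_mul_of_nonneg_right hcard hc.le) hK
    _ = _ := by ring

/-- The crux's analogue HOLDS at every subcritical parameter (with exponent `3`). -/
theorem freeBoxPowerSaving_analogue_below_criticalProb (p : unitInterval)
    (hp : (p : ℝ) < criticalProb (zdGraph 3) 0) :
    ∃ a C : ℝ, 0 < a ∧ ∀ n : ℕ, 1 ≤ n → fa2 p n ≤ C * (n : ℝ) ^ (-a) :=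
  ⟨3, ∑' z : Site 3, tau 3 p 0 z, by norm_num, fun n hn => fa2_subcritical_bound p hp hn⟩

/-! ## The crux ⟺ a centre-rooted free-susceptibility power saving below `R³` -/

/-- **`FreeBoxPowerSaving` ⟺ `∃ b < 3`, `Σ_{x∈B(R)} P_{p_c}(0 ↔ x in B(R)) = O(R^b)`.**
(→) `b = 3 - a` from `F(r) ≤ 64 FA₂(2r)`; (←) `a = 3 - b` from `FA₂(n) ≤ 8 F(2n)`
(`CentredForms.lean`), with `F(r) = |B(r)|⁻¹ Σ_{x∈B(r)} P(0 ↔ x in B(r))`. -/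
theorem freeBoxPowerSaving_iff_centredPowerSaving :
    FreeBoxPowerSaving ↔ ∃ b C : ℝ, b < 3 ∧ ∀ R : ℕ, 1 ≤ R →
      (∑ x ∈ box 3 R, (bondPercolation (zdGraph 3) (criticalProbI 3)).real
        (openConnIn (↑(box 3 R) : Set (Site 3)) 0 x)) ≤ C * (R : ℝ) ^ b := by
  rw [freeBoxPowerSaving_iff_fa2]
  constructor
  · rintro ⟨a, C, ha, hC⟩
    refine ⟨3 - a, 64 * 27 * max C 0 * (2 : ℝ) ^ (-a), by linarith, fun R hR => ?_⟩
    have hRpos : (0 : ℝ) < R := by exact_mod_cast hR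
    have hR1 : (1 : ℝ) ≤ R := by exact_mod_cast hR
    have hc := card_box_pos R
    have h2R : 1 ≤ 2 * R := by omega
    -- `F(R) ≤ 64 FA₂(2R) ≤ 64 C (2R)^{-a}`
    have hF : (∑ x ∈ box 3 R, (bondPercolation (zdGraph 3) (criticalProbI 3)).real
        (openConnIn (↑(box 3 R) : Set (Site 3)) 0 x)) / (box 3 R).card ≤
        64 * (max C 0 * ((2 : ℝ) ^ (-a) * (R : ℝ) ^ (-a))) := by
      refine (centredAvg_le_freePairAverage (criticalProbI 3) R).trans ?_
      refine mul_le_mul_of_nonneg_left ?_ (by norm_num)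
      have h1 : fa2 (criticalProbI 3) (2 * R) ≤ C * ((2 * R : ℕ) : ℝ) ^ (-a) := hC (2 * R) h2R
      have h2 : ((2 * R : ℕ) : ℝ) ^ (-a) = (2 : ℝ) ^ (-a) * (R : ℝ) ^ (-a) := by
        push_cast; exact Real.mul_rpow (by norm_num) hRpos.le
      rw [h2] at h1
      exact h1.trans (mul_le_mul_of_nonneg_right (le_max_left _ _)
        (mul_nonneg (Real.rpow_nonneg (by norm_num) _) (Real.rpow_nonneg hRpos.le _)))
    rw [div_le_iff₀ hc] at hF
    have hcard : ((box 3 R).card : ℝ) ≤ 27 * (R : ℝ) ^ 3 := by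
      rw [card_box_real]
      have h3 : 2 * (R : ℝ) + 1 ≤ 3 * R := by linarith
      calc (2 * (R : ℝ) + 1) ^ 3 ≤ (3 * R) ^ 3 := by gcongr
        _ = 27 * (R : ℝ) ^ 3 := by ring
    have hK : 0 ≤ 64 * (max C 0 * ((2 : ℝ) ^ (-a) * (R : ℝ) ^ (-a))) :=
      mul_nonneg (by norm_num) (mul_nonneg (le_max_right _ _)
        (mul_nonneg (Real.rpow_nonneg (by norm_num) _) (Real.rpow_nonneg hRpos.le _)))
    have hpow : (R : ℝ) ^ (-a) * (R : ℝ) ^ 3 = (R : ℝ) ^ (3 - a) := by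
      rw [← Real.rpow_natCast, ← Real.rpow_add hRpos]; push_cast; ring_nf
    calc _ ≤ 64 * (max C 0 * ((2 : ℝ) ^ (-a) * (R : ℝ) ^ (-a))) * ((box 3 R).card : ℝ) := hF
      _ ≤ 64 * (max C 0 * ((2 : ℝ) ^ (-a) * (R : ℝ) ^ (-a))) * (27 * (R : ℝ) ^ 3) :=
          mul_le_mul_of_nonneg_left hcard hK
      _ = 64 * 27 * max C 0 * (2 : ℝ) ^ (-a) * ((R : ℝ) ^ (-a) * (R : ℝ) ^ 3) := by ring
      _ = _ := by rw [hpow]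
  · rintro ⟨b, C, hb, hC⟩
    refine ⟨3 - b, max C 0 * (2 : ℝ) ^ b / 8, by linarith, fun n hn => ?_⟩
    have hnpos : (0 : ℝ) < n := by exact_mod_cast hn
    have hn1 : (1 : ℝ) ≤ n := by exact_mod_cast hn
    have h2n : 1 ≤ 2 * n := by omega
    have hc2 := card_box_pos (2 * n)
    -- `FA₂(n) ≤ 8 F(2n) ≤ 8 C (2n)^b / |B(2n)|`
    have hcs : (∑ x ∈ box 3 (2 * n), (bondPercolation (zdGraph 3) (criticalProbI 3)).real
        (openConnIn (↑(box 3 (2 * n)) : Set (Site 3)) 0 x)) ≤ max C 0 * ((2 : ℝ) ^ b * (n : ℝ) ^ b) := by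
      have h1 := hC (2 * n) h2n
      have h2 : ((2 * n : ℕ) : ℝ) ^ b = (2 : ℝ) ^ b * (n : ℝ) ^ b := by
        push_cast; exact Real.mul_rpow (by norm_num) hnpos.le
      rw [h2] at h1
      exact h1.trans (mul_le_mul_of_nonneg_right (le_max_left _ _)
        (mul_nonneg (Real.rpow_nonneg (by norm_num) _) (Real.rpow_nonneg hnpos.le _)))
    have hcard : 64 * (n : ℝ) ^ 3 ≤ ((box 3 (2 * n)).card : ℝ) := by
      rw [card_box_real]; push_cast
      have h4 : 4 * (n : ℝ) ≤ 2 * (2 * n) + 1 := by linarith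
      calc 64 * (n : ℝ) ^ 3 = (4 * n) ^ 3 := by ring
        _ ≤ (2 * (2 * (n : ℝ)) + 1) ^ 3 := by gcongr
    have hM : 0 ≤ max C 0 * ((2 : ℝ) ^ b * (n : ℝ) ^ b) :=
      mul_nonneg (le_max_right _ _) (mul_nonneg (Real.rpow_nonneg (by norm_num) _) (Real.rpow_nonneg hnpos.le _))
    have hpow : (n : ℝ) ^ b / (n : ℝ) ^ 3 = (n : ℝ) ^ (-(3 - b)) := by
      rw [← Real.rpow_natCast, ← Real.rpow_sub hnpos]; push_cast; ring_nf
    calc fa2 (criticalProbI 3) n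
        ≤ 8 * ((∑ x ∈ box 3 (2 * n), (bondPercolation (zdGraph 3) (criticalProbI 3)).real
            (openConnIn (↑(box 3 (2 * n)) : Set (Site 3)) 0 x)) / (box 3 (2 * n)).card) :=
          freePairAverage_le_centredAvg (criticalProbI 3) n
      _ ≤ 8 * (max C 0 * ((2 : ℝ) ^ b * (n : ℝ) ^ b) / (64 * (n : ℝ) ^ 3)) := by
          refine mul_le_mul_of_nonneg_left ?_ (by norm_num)
          exact (div_le_div_of_nonneg_right hcs hc2.le).trans
            (div_le_div_of_nonneg_left hM (by positivity) hcard)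
      _ = max C 0 * (2 : ℝ) ^ b / 8 * ((n : ℝ) ^ b / (n : ℝ) ^ 3) := by ring
      _ = max C 0 * (2 : ℝ) ^ b / 8 * (n : ℝ) ^ (-(3 - b)) := by rw [hpow]

end

end Summit.CriticalPhenomena.PercolationContinuityZ3.FreeBoxPowerSavingNegative
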